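import Summits.Ventures.LatticeQCDFlow.Exactness.AcceptanceFromMeanEnergyViolationPinsker
import Summits.Ventures.LatticeQCDFlow.Exactness.Phi4MetropolisSiteInvolution
import HarnessLib

/-!
# The local arm's Pinsker floor: `1 − ⟨a_x⟩ ≤ √(⟨ΔS_x⟩/2)` for the single-site Metropolis update

HONEST FRAMING: exact (Metropolis-corrected) sampling algorithms for lattice gauge theory;
figures of merit are autocorrelation/cost numbers at stated couplings and volumes; no
continuum-physics claim.  (SCALAR calibration rung S0-A: not a gauge result.)

Venture `LatticeQCDFlow` (cell pub-lqcd), topic `Exactness`; FANOUT row 2 (`s0-phi4`, LOCAL arm).  NEW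
WORK of the cell, the two-line sequel of `AcceptanceFromMeanEnergyViolationPinsker` (the abstract
Pinsker floor `involutive_acceptance_ge_pinsker` for every measure-preserving involution) and
`Phi4MetropolisSiteInvolution` (the single-site random-walk Metropolis update IS such an involution,
`Ψ_x(u, φ) = (−u, φ + u e_x)`, `ΔH = ΔS_x`), both of this session: the site acceptance is floored by
the mean proposed action increase in Pinsker form, sharper than the Bretagnolle–Huber form of the
parent file whenever `⟨ΔS_x⟩ < 1.59`.  Nothing is cited as a fact.

* **`metropolisSite_acceptance_ge_pinsker`** — `S` measurable, `e^{−S}` integrable; `ρ > 0` even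
  measurable, `∫ ρ = 1`; `ΔS_x ρ e^{−S} ∈ L¹(du dφ)`:
  `∫∫ min(1, e^{−ΔS_x}) ρ(u) e^{−S(φ)} du dφ ≥ (1 − √(⟨ΔS_x⟩/2)) · Z`;
* **`phi4MetropolisSite_acceptance_ge_pinsker`** — lattice φ⁴, `λ > 0`, real `J`, every site, every
  positive even step density;
* **`metropolisScan_acceptance_ge_pinsker`** — the scan over any finite set of sites: acceptance
  `≥ 1 − √(m̄/2)`, `m̄` the scan's mean proposed action increase.

NOT CLAIMED: as in the parents (first-moment integrability is the hypothesis `hΔ`; window densities;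
values for any run).
-/

namespace Summit.Ventures.LatticeQCDFlow.Exactness

open Real MeasureTheory Filter
open Summit.Ventures.LatticeQCDFlow.Scoring

section Site

variable {n : ℕ}

/-- **PINSKER'S FLOOR FOR THE SITE-METROPOLIS ACCEPTANCE, GENERAL ACTION**:
`∫∫ min(1, e^{−ΔS_x}) ρ e^{−S} ≥ (1 − √(⟨ΔS_x⟩/2)) · Z`. -/
theorem metropolisSite_acceptance_ge_pinsker {S : (Fin (n + 1) → ℝ) → ℝ} (hSm : Measurable S)
    (hSi : Integrable (fun φ => Real.exp (-S φ))) {ρ : ℝ → ℝ} (hρ0 : ∀ u, 0 < ρ u)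
    (hρm : Measurable ρ) (hρs : ∀ u, ρ (-u) = ρ u) (hρ1 : ∫ u, ρ u = 1) (x : Fin (n + 1))
    (hΔ : Integrable (fun p : ℝ × (Fin (n + 1) → ℝ) =>
      (S (p.2 + Pi.single x p.1) - S p.2) * (Real.exp (-S p.2) * ρ p.1))
      ((volume : Measure ℝ).prod (volume : Measure (Fin (n + 1) → ℝ)))) :
    (1 - Real.sqrt (((∫ p, (S (p.2 + Pi.single x p.1) - S p.2)
        * (Real.exp (-S p.2) * ρ p.1) ∂((volume : Measure ℝ).prod (volume : Measure (Fin (n + 1) → ℝ))))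
        / ∫ φ, Real.exp (-S φ)) / 2))
      * ∫ φ, Real.exp (-S φ)
      ≤ ∫ p, min 1 (Real.exp (-(S (p.2 + Pi.single x p.1) - S p.2))) * (Real.exp (-S p.2) * ρ p.1)
          ∂((volume : Measure ℝ).prod (volume : Measure (Fin (n + 1) → ℝ))) := by
  set μ2 : Measure (ℝ × (Fin (n + 1) → ℝ)) :=
    (volume : Measure ℝ).prod (volume : Measure (Fin (n + 1) → ℝ)) with hμ2
  set H : ℝ × (Fin (n + 1) → ℝ) → ℝ := fun q => S q.2 - Real.log (ρ q.1) with hH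
  set Ψ : ℝ × (Fin (n + 1) → ℝ) → ℝ × (Fin (n + 1) → ℝ) := fun q => (-q.1, q.2 + Pi.single x q.1) with hΨ
  have hHm : Measurable H := (hSm.comp measurable_snd).sub ((Real.measurable_log.comp hρm).comp measurable_fst)
  have hexpH : ∀ q, Real.exp (-H q) = Real.exp (-S q.2) * ρ q.1 := fun q => exp_neg_H_site S hρ0 q
  have hρi : Integrable ρ := by
    by_contra h
    rw [integral_undef h] at hρ1
    exact zero_ne_one hρ1
  have hw : Integrable (fun q => Real.exp (-H q)) μ2 := by
    simp_rw [hexpH]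
    have h := (hρi.mul_prod hSi : Integrable (fun q : ℝ × (Fin (n + 1) → ℝ) => ρ q.1 * Real.exp (-S q.2)) μ2)
    exact h.congr (Eventually.of_forall fun q => by ring)
  have hZeq : ∫ q, Real.exp (-H q) ∂μ2 = ∫ φ, Real.exp (-S φ) := by
    simp_rw [hexpH]
    have h := integral_prod_mul (μ := (volume : Measure ℝ)) (ν := (volume : Measure (Fin (n + 1) → ℝ)))
      ρ (fun φ => Real.exp (-S φ))
    rw [show (fun q : ℝ × (Fin (n + 1) → ℝ) => Real.exp (-S q.2) * ρ q.1)
        = fun q => ρ q.1 * Real.exp (-S q.2) from funext fun q => mul_comm _ _, h, hρ1, one_mul]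
  have hZ : 0 < ∫ q, Real.exp (-H q) ∂μ2 := by rw [hZeq]; exact integral_exp_pos hSi
  have hΔH : ∀ q, deltaH H Ψ q = S (q.2 + Pi.single x q.1) - S q.2 := fun q => deltaH_site_eq S hρs x q
  have hΔ' : Integrable (fun q => deltaH H Ψ q * Real.exp (-H q)) μ2 :=
    hΔ.congr (Eventually.of_forall fun q => by simp only [hΔH, hexpH])
  have key := involutive_acceptance_ge_pinsker hHm (measurable_siteShear x) (siteShear_involutive x)
    (measurePreserving_siteShear x) hw hΔ' hZ
  have e1 : ∫ q, deltaH H Ψ q * Real.exp (-H q) ∂μ2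
      = ∫ q, (S (q.2 + Pi.single x q.1) - S q.2) * (Real.exp (-S q.2) * ρ q.1) ∂μ2 :=
    integral_congr_ae (Eventually.of_forall fun q => by simp only [hΔH, hexpH])
  have e2 : ∫ q, min 1 (Real.exp (-deltaH H Ψ q)) * Real.exp (-H q) ∂μ2
      = ∫ q, min 1 (Real.exp (-(S (q.2 + Pi.single x q.1) - S q.2))) * (Real.exp (-S q.2) * ρ q.1) ∂μ2 :=
    integral_congr_ae (Eventually.of_forall fun q => by simp only [hΔH, hexpH])
  rw [e1, e2, hZeq] at key
  exact key

/-- **PINSKER'S FLOOR FOR THE SITE-METROPOLIS ACCEPTANCE OF LATTICE φ⁴** (`λ > 0`, real `J`, every site,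
every positive even step density with `∫ ρ = 1`; first moment of `ΔS_x` as hypothesis):
`∫∫ min(1, e^{−ΔS_x}) ρ(u) e^{−S(φ)} du dφ ≥ (1 − √(⟨ΔS_x⟩/2)) · Z`. -/
theorem phi4MetropolisSite_acceptance_ge_pinsker {lam : ℝ} (hlam : 0 < lam)
    (J : Fin (n + 1) → Fin (n + 1) → ℝ) {ρ : ℝ → ℝ} (hρ0 : ∀ u, 0 < ρ u) (hρm : Measurable ρ)
    (hρs : ∀ u, ρ (-u) = ρ u) (hρ1 : ∫ u, ρ u = 1) (x : Fin (n + 1))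
    (hΔ : Integrable (fun p : ℝ × (Fin (n + 1) → ℝ) =>
      (latticePhi4Action J lam (p.2 + Pi.single x p.1) - latticePhi4Action J lam p.2)
        * (gibbsWeight J lam p.2 * ρ p.1))
      ((volume : Measure ℝ).prod (volume : Measure (Fin (n + 1) → ℝ)))) :
    (1 - Real.sqrt (((∫ p, (latticePhi4Action J lam (p.2 + Pi.single x p.1)
        - latticePhi4Action J lam p.2) * (gibbsWeight J lam p.2 * ρ p.1)
          ∂((volume : Measure ℝ).prod (volume : Measure (Fin (n + 1) → ℝ)))) / gibbsZ J lam) / 2))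
      * gibbsZ J lam
      ≤ ∫ p, min 1 (Real.exp (-(latticePhi4Action J lam (p.2 + Pi.single x p.1)
          - latticePhi4Action J lam p.2))) * (gibbsWeight J lam p.2 * ρ p.1)
          ∂((volume : Measure ℝ).prod (volume : Measure (Fin (n + 1) → ℝ))) :=
  metropolisSite_acceptance_ge_pinsker (continuous_latticePhi4Action J lam).measurable
    (integrable_gibbsWeight hlam J) hρ0 hρm hρs hρ1 x hΔ

/-- **PINSKER'S FLOOR FOR THE SCAN**: summed over any finite set of sites `s`,
`Σ_{x∈s} ∫∫ min(1, e^{−ΔS_x}) ρ e^{−S} ≥ (|s| − √(|s| Σ_x ⟨ΔS_x⟩ / 2))·Z`, i.e. the scan's acceptance is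
at least `1 − √(m̄/2)`, `m̄ = |s|⁻¹ Σ_x ⟨ΔS_x⟩` (site floors + Cauchy–Schwarz). -/
theorem metropolisScan_acceptance_ge_pinsker {S : (Fin (n + 1) → ℝ) → ℝ} (hSm : Measurable S)
    (hSi : Integrable (fun φ => Real.exp (-S φ))) {ρ : ℝ → ℝ} (hρ0 : ∀ u, 0 < ρ u)
    (hρm : Measurable ρ) (hρs : ∀ u, ρ (-u) = ρ u) (hρ1 : ∫ u, ρ u = 1) (s : Finset (Fin (n + 1)))
    (hΔ : ∀ x ∈ s, Integrable (fun p : ℝ × (Fin (n + 1) → ℝ) =>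
      (S (p.2 + Pi.single x p.1) - S p.2) * (Real.exp (-S p.2) * ρ p.1))
      ((volume : Measure ℝ).prod (volume : Measure (Fin (n + 1) → ℝ))))
    (hm0 : ∀ x ∈ s, 0 ≤ (∫ p, (S (p.2 + Pi.single x p.1) - S p.2) * (Real.exp (-S p.2) * ρ p.1)
      ∂((volume : Measure ℝ).prod (volume : Measure (Fin (n + 1) → ℝ)))) / ∫ φ, Real.exp (-S φ)) :
    ((s.card : ℝ) - Real.sqrt (s.card * ∑ x ∈ s,
        ((∫ p, (S (p.2 + Pi.single x p.1) - S p.2) * (Real.exp (-S p.2) * ρ p.1)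
          ∂((volume : Measure ℝ).prod (volume : Measure (Fin (n + 1) → ℝ)))) / ∫ φ, Real.exp (-S φ)) / 2))
      * ∫ φ, Real.exp (-S φ)
      ≤ ∑ x ∈ s, ∫ p, min 1 (Real.exp (-(S (p.2 + Pi.single x p.1) - S p.2)))
          * (Real.exp (-S p.2) * ρ p.1) ∂((volume : Measure ℝ).prod (volume : Measure (Fin (n + 1) → ℝ))) := by
  set Z : ℝ := ∫ φ, Real.exp (-S φ) with hZdef
  set m : Fin (n + 1) → ℝ := fun x => (∫ p, (S (p.2 + Pi.single x p.1) - S p.2)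
      * (Real.exp (-S p.2) * ρ p.1) ∂((volume : Measure ℝ).prod (volume : Measure (Fin (n + 1) → ℝ)))) / Z
    with hmdef
  have hZ : 0 < Z := integral_exp_pos hSi
  have hsite : ∀ x ∈ s, (1 - Real.sqrt (m x / 2)) * Z
      ≤ ∫ p, min 1 (Real.exp (-(S (p.2 + Pi.single x p.1) - S p.2))) * (Real.exp (-S p.2) * ρ p.1)
          ∂((volume : Measure ℝ).prod (volume : Measure (Fin (n + 1) → ℝ))) :=
    fun x hx => metropolisSite_acceptance_ge_pinsker hSm hSi hρ0 hρm hρs hρ1 x (hΔ x hx)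
  have hsum := Finset.sum_le_sum hsite
  refine le_trans ?_ hsum
  rw [← Finset.sum_mul, Finset.sum_sub_distrib, Finset.sum_const, nsmul_eq_mul, mul_one]
  -- Cauchy–Schwarz for square roots with `m_x/2`
  have hcs : ∑ x ∈ s, Real.sqrt (m x / 2) ≤ Real.sqrt (s.card * ∑ x ∈ s, m x / 2) := by
    have hm2 : ∀ x ∈ s, 0 ≤ m x / 2 := fun x hx => div_nonneg (hm0 x hx) two_pos.le
    have h := Finset.sum_mul_sq_le_sq_mul_sq s (fun _ => (1:ℝ)) (fun x => Real.sqrt (m x / 2))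
    simp only [one_pow, Finset.sum_const, nsmul_eq_mul, mul_one, one_mul] at h
    have e : ∑ x ∈ s, Real.sqrt (m x / 2) ^ 2 = ∑ x ∈ s, m x / 2 :=
      Finset.sum_congr rfl fun x hx => Real.sq_sqrt (hm2 x hx)
    rw [e] at h
    have h0 : 0 ≤ ∑ x ∈ s, Real.sqrt (m x / 2) := Finset.sum_nonneg fun x _ => Real.sqrt_nonneg _
    calc ∑ x ∈ s, Real.sqrt (m x / 2) = Real.sqrt ((∑ x ∈ s, Real.sqrt (m x / 2)) ^ 2) := by
          rw [Real.sqrt_sq h0]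
      _ ≤ Real.sqrt (s.card * ∑ x ∈ s, m x / 2) := Real.sqrt_le_sqrt h
  have e2 : (∑ x ∈ s, (∫ p, (S (p.2 + Pi.single x p.1) - S p.2) * (Real.exp (-S p.2) * ρ p.1)
      ∂((volume : Measure ℝ).prod (volume : Measure (Fin (n + 1) → ℝ)))) / (∫ φ, Real.exp (-S φ)) / 2)
      = ∑ x ∈ s, m x / 2 := Finset.sum_congr rfl fun x _ => rfl
  rw [e2]
  exact mul_le_mul_of_nonneg_right (by linarith [hcs]) hZ.le

end Site

end Summit.Ventures.LatticeQCDFlow.Exactness
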